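import Literature.NumberTheory.Automorphic.UnitaryGroupGeometricSide
import HarnessLib

/-!
# Finitely many conjugacy classes contribute: the geometric side of the trace formula for an
anisotropic group is a FINITE sum for each test function
(Rogawski, *Automorphic representations of unitary groups in three variables* (1990), §14.5 p. 237
(print): the `O`-expansion of `T_{G′}(f′)` for the anisotropic `G′` is finitely supported in the
(stable) classes for each `f′`; Gelfand–Graev–Piatetski-Shapiro (1969), Ch. 1 §2)

Topic `NumberTheory/Automorphic`; namespace `Literature.NumberTheory.Automorphic` (grouping
sub-namespaces `AdelicGroupData`, `UnitaryGroup`). Proof file: theorems only, no definition, no named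
fact, no `sorry`; imports = tree.

Companion of `UnitaryGroupTraceClasses` / `UnitaryGroupGeometricSide` (the geometric side
`∫_X K_Φ(x, x) dμ = κ Σ'_{[γ]} d_{[γ]} O_{[γ]}(Φ)` for data with `A_G = ⊥` and for the unitary group
`U(H)` of an anisotropic hermitian matrix over a CM field). Here:

* `finite_conjClasses_meeting_isCompact` — **the topological lemma**: `G` locally compact
  Hausdorff, `L ≤ G` with `G ⧸ L` compact, `Γ` DISCRETE with `L ⊆ Γ · C_G(Γ)`, `S ⊆ G` compact.
  Then only FINITELY many `Γ`-conjugacy classes have a `G`-conjugate in `S`: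
  `{[γ] : ∃ g ∈ G, g γ g⁻¹ ∈ S}` is finite. Proof (the finite-set argument of
  `exists_isCompact_centralizer_subset_mul`): `G = C · L`, so `g = c δ a` with `c ∈ C`, `δ ∈ Γ`,
  `a ∈ C(Γ)`; `g γ g⁻¹ ∈ S` gives `δ γ δ⁻¹ ∈ Γ ∩ C⁻¹ S C`, a finite set, and `[γ] = [δ γ δ⁻¹]`.
* `AdelicGroupData.finite_conjClasses_meeting_isCompact` — the same for any adelic group datum with
  discrete `G(K)` and compact automorphic quotient (`L = A_G · G(K)`);
  `UnitaryGroup.finite_conjClasses_meeting_isCompact_cmDatum` — for `U(H)`, `H` anisotropic.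
* if no `G`-conjugate of `γ` meets `tsupport Φ` then the orbital integrand `y ↦ Φ(y γ y⁻¹)`
  (`descConj`) vanishes identically; hence `AdelicGroupData.exists_finset_descConj_eq_zero` /
  `UnitaryGroup.exists_finset_descConj_eq_zero_cmDatum`: for `Φ ∈ C_c(G(𝔸), E)` there is a finite
  set `s` of classes off which EVERY orbital integrand of `Φ` (for any centralising subgroups) is the
  zero function — so for any measures `μ_c` and weights `w_c` the class function
  `c ↦ w_c ∫ Φ(y γ_c y⁻¹) dμ_c` is supported in `s`, and the series of `UnitaryGroupGeometricSide`
  are finite sums (`tsum_eq_sum`);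
* `UnitaryGroup.hasSum_norm_sq_integratedOperator_eq_const_mul_sum_orbital_cmDatum` — **the simple
  trace formula for `U(H)` in Hilbert–Schmidt form as a FINITE sum**:
  `Σ_i ‖R(f) e_i‖² = C · Σ_{c ∈ s} d_c O_{γ_c}(f ⋆ f^*)` — the clause "`Σ_{𝒪} J(𝒪, f′)` is a finite
  sum for each `f′`" of Rogawski's simple trace formula for the anisotropic inner form
  [§14.5 p. 237 (print)], in the instance-free currency of the floor-0 line.

What is deliberately NOT here: stable classes (the grouping of `s` by stable conjugacy), any bound on
`#s`, normalisation of constants, the kernel-form finite sum (immediate from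
`integral_quotientKernel_diag_eq_mul_tsum_cmDatum` and `exists_finset_descConj_eq_zero_cmDatum` under
the quotient-form instances of `UnitaryGroupGeometricSide`).

## References

* J. D. Rogawski, *Automorphic Representations of Unitary Groups in Three Variables*, Ann. of Math.
  Stud. 123 (1990), §14.5 p. 237 (print) [Rogawski1990].
* I. M. Gelfand, M. I. Graev, I. I. Piatetski-Shapiro, *Representation Theory and Automorphic
  Functions* (1969), Ch. 1 §2 [GelfandGraevPiatetskiShapiro1969].
* S. Gelbart, *Automorphic forms on adele groups*, Ann. of Math. Stud. 83 (1975), (9.13), Remark 9.23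
  [Gelbart1975].
-/

noncomputable section

open MeasureTheory Measure Set Filter Topology NumberField CompactlySupported
open Literature.MeasureTheory.Group
open scoped ENNReal NNReal Pointwise

namespace Literature.NumberTheory.Automorphic

universe u

/-! ### Finitely many classes meet a compact set -/

section Classes

variable {G : Type*} [Group G] [TopologicalSpace G] [IsTopologicalGroup G] [LocallyCompactSpace G]
  [T2Space G] (L Γ : Subgroup G)

/-- **Only finitely many `Γ`-conjugacy classes have a `G`-conjugate in a given compact set.** Let `G`
be a locally compact Hausdorff group, `L ≤ G` a subgroup with `G ⧸ L` compact, `Γ` a DISCRETE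
subgroup with `L ⊆ Γ · C_G(Γ)` (e.g. `L = A Γ`, `A` central, or `L = Γ`), and `S ⊆ G` compact. Then
the set of conjugacy classes `[γ]` of `Γ` such that `g γ g⁻¹ ∈ S` for some `γ ∈ [γ]` and `g ∈ G` is
finite. Proof: `G = C · L` with `C` compact; `g = c δ a` (`c ∈ C`, `δ ∈ Γ`, `a` centralising `Γ`),
so `δ γ δ⁻¹ = c⁻¹ (g γ g⁻¹) c ∈ Γ ∩ C⁻¹ S C`, a finite set (discrete meets compact), and
`[γ] = [δ γ δ⁻¹]`. This is why the geometric side of the trace formula for a uniform lattice is a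
finite sum for each compactly supported test function (Gelfand–Graev–Piatetski-Shapiro (1969),
Ch. 1 §2). [cite: GelfandGraevPiatetskiShapiro1969, Ch. 1 §2] -/
theorem finite_conjClasses_meeting_isCompact
    (hL : ∀ ℓ ∈ L, ∃ γ ∈ Γ, γ⁻¹ * ℓ ∈ Subgroup.centralizer (Γ : Set G))
    [DiscreteTopology Γ] [CompactSpace (G ⧸ L)] {S : Set G} (hS : IsCompact S) :
    {c : ConjClasses Γ | ∃ γ : Γ, ConjClasses.mk γ = c ∧ ∃ g : G, g * (γ : G) * g⁻¹ ∈ S}.Finite := by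
  classical
  -- `G = C · L` with `C` compact
  obtain ⟨C, hC, hCuniv⟩ := exists_isCompact_image_mk_superset L (isCompact_univ (X := G ⧸ L))
  have hdec : ∀ g : G, ∃ c ∈ C, c⁻¹ * g ∈ L := fun g => by
    obtain ⟨c, hc, hcg⟩ := hCuniv (Set.mem_univ (QuotientGroup.mk g : G ⧸ L))
    exact ⟨c, hc, QuotientGroup.eq.1 hcg⟩
  -- the compact set `T = C⁻¹ S C` meets the discrete closed `Γ` in a finite set
  set T : Set G := (fun p : G × G => p.1⁻¹ * p.2 * p.1) '' (C ×ˢ S) with hT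
  have hTc : IsCompact T := (hC.prod hS).image (by fun_prop)
  have hΓc : IsClosed ((Γ : Subgroup G) : Set G) := Subgroup.isClosed_of_discrete
  have hΓd : IsDiscrete ((Γ : Subgroup G) : Set G) :=
    isDiscrete_iff_discreteTopology.mpr ‹DiscreteTopology Γ›
  have hfin : (T ∩ (Γ : Set G)).Finite :=
    (hTc.inter_right hΓc).finite (hΓd.mono Set.inter_subset_right)
  -- the classes of the elements of `T ∩ Γ`
  have hfin' : {γ : Γ | (γ : G) ∈ T}.Finite :=
    (hfin.preimage Subtype.val_injective.injOn).subset fun γ hγ => ⟨hγ, γ.2⟩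
  refine (hfin'.image fun γ : Γ => ConjClasses.mk γ).subset ?_
  rintro c ⟨γ, rfl, g, hg⟩
  -- decompose `g = c₀ δ a`
  obtain ⟨c₀, hc₀, hℓ⟩ := hdec g
  obtain ⟨δ, hδ, ha⟩ := hL _ hℓ
  set a : G := δ⁻¹ * (c₀⁻¹ * g) with ha_def
  have hg' : g = c₀ * δ * a := by rw [ha_def]; group
  have haγ : (γ : G) * a = a * γ := (Subgroup.mem_centralizer_iff.1 ha) γ γ.2
  -- `δ γ δ⁻¹ = c₀⁻¹ (g γ g⁻¹) c₀ ∈ T`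
  have ht : c₀⁻¹ * (g * γ * g⁻¹) * c₀ = δ * γ * δ⁻¹ := by
    calc c₀⁻¹ * (g * γ * g⁻¹) * c₀ = δ * (a * γ) * a⁻¹ * δ⁻¹ := by rw [hg']; group
      _ = δ * (γ * a) * a⁻¹ * δ⁻¹ := by rw [haγ]
      _ = δ * γ * δ⁻¹ := by group
  refine ⟨⟨δ * γ * δ⁻¹, Γ.mul_mem (Γ.mul_mem hδ γ.2) (Γ.inv_mem hδ)⟩,
    ⟨(c₀, g * γ * g⁻¹), ⟨hc₀, hg⟩, ht⟩, ?_⟩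
  -- `[δ γ δ⁻¹] = [γ]` in `Γ`
  rw [ConjClasses.mk_eq_mk_iff_isConj, isConj_iff]
  exact ⟨⟨δ⁻¹, Γ.inv_mem hδ⟩, Subtype.ext (by simp only [Subgroup.coe_mul, InvMemClass.coe_inv]; group)⟩

end Classes

/-! ### Orbital integrands of test functions vanish off finitely many classes -/

section Vanishing

variable {G : Type*} [Group G] [TopologicalSpace G]

/-- If no `G`-conjugate of `γ` lies in the topological support of `Φ`, the orbital integrand
`y M ↦ Φ(y γ y⁻¹)` (`descConj`) is identically zero. [folklore] -/
private theorem descConj_eq_zero_of_forall_notMem_tsupport {γ : G} (M : Subgroup G)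
    (hM : ∀ m ∈ M, m * γ = γ * m) {E : Type*} [Zero E] {Φ : G → E}
    (h : ∀ g : G, g * γ * g⁻¹ ∉ tsupport Φ) : descConj γ M hM Φ = 0 := by
  funext y
  induction y using QuotientGroup.induction_on with
  | H g =>
    show Φ (g * γ * g⁻¹) = 0
    exact image_eq_zero_of_notMem_tsupport (h g)

end Vanishing

/-! ### Adelic group data -/

namespace AdelicGroupData

variable {K : Type} [Field K] [NumberField K] (𝒢 : AdelicGroupData.{u} K)

/-- **Finitely many conjugacy classes of `G(K)` have a `G(𝔸_K)`-conjugate in a compact set**, on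
an adelic group datum with discrete `G(K)` and COMPACT automorphic quotient
(`finite_conjClasses_meeting_isCompact` with `L = A_G · G(K)`). This is the finiteness of the
geometric side of the trace formula on a compact quotient for each compactly supported test function
(Gelbart (1975), Remark 9.23; Gelfand–Graev–Piatetski-Shapiro (1969), Ch. 1 §2).
[cite: Gelbart1975, Remark 9.23] -/
theorem finite_conjClasses_meeting_isCompact [LocallyCompactSpace 𝒢.Adelic] [T2Space 𝒢.Adelic]
    (hdisc : 𝒢.IsDiscreteRational) [CompactSpace 𝒢.automorphicQuotient] {S : Set 𝒢.Adelic}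
    (hS : IsCompact S) :
    {c : ConjClasses 𝒢.arithmeticSubgroup | ∃ γ : 𝒢.arithmeticSubgroup, ConjClasses.mk γ = c ∧
      ∃ g : 𝒢.Adelic, g * (γ : 𝒢.Adelic) * g⁻¹ ∈ S}.Finite := by
  haveI : DiscreteTopology 𝒢.arithmeticSubgroup := hdisc
  haveI : CompactSpace (𝒢.Adelic ⧸ 𝒢.quotientSubgroup) := ‹CompactSpace 𝒢.automorphicQuotient›
  exact Literature.NumberTheory.Automorphic.finite_conjClasses_meeting_isCompact 𝒢.quotientSubgroup
    𝒢.arithmeticSubgroup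
    (exists_inv_mul_mem_centralizer_of_le_center 𝒢.arithmeticSubgroup 𝒢.center' 𝒢.center'_le) hS

/-- **The orbital integrals of a test function are finitely supported in the classes**: for
`Φ ∈ C_c(G(𝔸_K))` (datum with discrete `G(K)`, compact automorphic quotient) there is a finite set
`s` of conjugacy classes of `G(K)` off which EVERY orbital integrand `y ↦ Φ(y γ_c y⁻¹)`
(`γ_c = out c`, any centralising subgroups `M_c`) vanishes identically — so for any measures `μ_c` and
weights `w_c` the class function `c ↦ w_c ∫ Φ(y γ_c y⁻¹) dμ_c` is supported in `s`.
[cite: Gelbart1975, Remark 9.23] -/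
theorem exists_finset_descConj_eq_zero [LocallyCompactSpace 𝒢.Adelic] [T2Space 𝒢.Adelic]
    (hdisc : 𝒢.IsDiscreteRational) [CompactSpace 𝒢.automorphicQuotient] {E : Type*} [Zero E]
    [TopologicalSpace E] (Φ : C_c(𝒢.Adelic, E))
    (M : ConjClasses 𝒢.arithmeticSubgroup → Subgroup 𝒢.Adelic)
    (hM : ∀ c, ∀ m ∈ M c, m * ((Quotient.out c : 𝒢.arithmeticSubgroup) : 𝒢.Adelic) =
      ((Quotient.out c : 𝒢.arithmeticSubgroup) : 𝒢.Adelic) * m) :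
    ∃ s : Finset (ConjClasses 𝒢.arithmeticSubgroup), ∀ c ∉ s,
      descConj ((Quotient.out c : 𝒢.arithmeticSubgroup) : 𝒢.Adelic) (M c) (hM c) (⇑Φ) = 0 := by
  have hfin := 𝒢.finite_conjClasses_meeting_isCompact hdisc Φ.hasCompactSupport
  refine ⟨hfin.toFinset, fun c hc => descConj_eq_zero_of_forall_notMem_tsupport (M c) (hM c)
    fun g hg => hc (hfin.mem_toFinset.2 ⟨Quotient.out c, ?_, g, hg⟩)⟩
  rw [← ConjClasses.quotient_mk_eq_mk]
  exact Quotient.out_eq c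

end AdelicGroupData

/-! ### The unitary group of an anisotropic hermitian matrix over a CM field -/

namespace UnitaryGroup

open Literature.AlgebraicGeometry.ShimuraVarieties (hermForm)

variable (L : Type) [Field L] [NumberField L] [IsCMField L] (N : ℕ) (H : Matrix (Fin N) (Fin N) L)

/-- **Finitely many classes of `U(H)(L⁺)` meet a compact subset of `U(H)(𝔸_{L⁺})` under
conjugation**, for `H` anisotropic (compact automorphic quotient by Godement's criterion,
`compactSpace_cmDatum_automorphicQuotient`; discrete rational points, `cmDatum_isDiscreteRational`).
[cite: Rogawski1990, §14.5 p. 237] -/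
theorem finite_conjClasses_meeting_isCompact_cmDatum
    (hanis : ∀ x : Fin N → L, hermForm (cmConjRingHom L) H x x = 0 → x = 0)
    {S : Set (cmDatum L N H).Adelic} (hS : IsCompact S) :
    {c : ConjClasses (cmDatum L N H).arithmeticSubgroup |
      ∃ γ : (cmDatum L N H).arithmeticSubgroup, ConjClasses.mk γ = c ∧
        ∃ g : (cmDatum L N H).Adelic, g * (γ : (cmDatum L N H).Adelic) * g⁻¹ ∈ S}.Finite := by
  haveI := compactSpace_cmDatum_automorphicQuotient L N H hanis
  exact (cmDatum L N H).finite_conjClasses_meeting_isCompact (cmDatum_isDiscreteRational L N H) hS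

/-- **The orbital integrands of a test function on `U(H)(𝔸)` vanish off finitely many classes**
(`H` anisotropic): for `Φ ∈ C_c(U(H)(𝔸_{L⁺}), E)` there is a finite set `s` of conjugacy classes of
`U(H)(L⁺)` with `y ↦ Φ(y γ_c y⁻¹) ≡ 0` for `c ∉ s` — "finitely many classes contribute to the
`O`-expansion of `T_{G′}(f′)`". [cite: Rogawski1990, §14.5 p. 237] -/
theorem exists_finset_descConj_eq_zero_cmDatum
    (hanis : ∀ x : Fin N → L, hermForm (cmConjRingHom L) H x x = 0 → x = 0)
    {E : Type*} [Zero E] [TopologicalSpace E] (Φ : C_c((cmDatum L N H).Adelic, E))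
    (M : ConjClasses (cmDatum L N H).arithmeticSubgroup → Subgroup (cmDatum L N H).Adelic)
    (hM : ∀ c, ∀ m ∈ M c, m * ((Quotient.out c : (cmDatum L N H).arithmeticSubgroup) :
        (cmDatum L N H).Adelic) =
      ((Quotient.out c : (cmDatum L N H).arithmeticSubgroup) : (cmDatum L N H).Adelic) * m) :
    ∃ s : Finset (ConjClasses (cmDatum L N H).arithmeticSubgroup), ∀ c ∉ s,
      descConj ((Quotient.out c : (cmDatum L N H).arithmeticSubgroup) : (cmDatum L N H).Adelic)
        (M c) (hM c) (⇑Φ) = 0 := by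
  haveI := compactSpace_cmDatum_automorphicQuotient L N H hanis
  exact (cmDatum L N H).exists_finset_descConj_eq_zero (cmDatum_isDiscreteRational L N H) Φ M hM

variable [MeasurableSpace (cmDatum L N H).Adelic] [BorelSpace (cmDatum L N H).Adelic]
  [∀ γ : (cmDatum L N H).Adelic, MeasurableSpace ((cmDatum L N H).Adelic ⧸
    Subgroup.centralizer ({γ} : Set (cmDatum L N H).Adelic))]
  [∀ γ : (cmDatum L N H).Adelic, BorelSpace ((cmDatum L N H).Adelic ⧸
    Subgroup.centralizer ({γ} : Set (cmDatum L N H).Adelic))]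

/-- **The simple trace formula for `U(H)` in Hilbert–Schmidt form is a FINITE sum for each `f`**
(Rogawski (1990), §14.5 p. 237 (print), `G′` anisotropic: `tr ρ(f′) = Σ_γ a_γ Φ_γ(f′)` with
finitely many non-zero terms): with the constants `C > 0`, `d_c ∈ (0, ∞)` and orbital measures `μ_c`
of `hasSum_norm_sq_integratedOperator_eq_const_mul_tsum_orbital_cmDatum`, for every
`f ∈ C_c(U(H)(𝔸))` there is a finite set `s` of conjugacy classes of `U(H)(L⁺)` (those meeting
`tsupport (f ⋆ f^*)`) off which the orbital integrands of `f ⋆ f^*` vanish identically, and for every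
countable Hilbert basis `(e_i)` of `L²(X, μ)`

  `Σ_i ‖R(f) e_i‖² = C · Σ_{c ∈ s} d_c ∫ (f ⋆ f^*)(y γ_c y⁻¹) dμ_c(y)`.

[cite: Rogawski1990, §14.5 p. 237] -/
theorem hasSum_norm_sq_integratedOperator_eq_const_mul_sum_orbital_cmDatum
    (hanis : ∀ x : Fin N → L, hermForm (cmConjRingHom L) H x x = 0 → x = 0)
    (μ : Measure (cmDatum L N H).automorphicQuotient) [(cmDatum L N H).IsAutomorphicMeasure μ]
    (ν : Measure (cmDatum L N H).Adelic) [ν.IsHaarMeasure] :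
    ∃ (C : ℝ≥0) (dc : ConjClasses (cmDatum L N H).arithmeticSubgroup → ℝ≥0∞)
      (μC : ∀ c : ConjClasses (cmDatum L N H).arithmeticSubgroup, Measure ((cmDatum L N H).Adelic ⧸
        Subgroup.centralizer ({((Quotient.out c : (cmDatum L N H).arithmeticSubgroup) :
          (cmDatum L N H).Adelic)} : Set (cmDatum L N H).Adelic))),
      0 < C ∧ (∀ c, dc c ≠ 0 ∧ dc c ≠ ∞) ∧
      (∀ c, SMulInvariantMeasure (cmDatum L N H).Adelic _ (μC c) ∧
        IsFiniteMeasureOnCompacts (μC c) ∧ μC c ≠ 0) ∧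
      ∀ (f : C_c((cmDatum L N H).Adelic, ℂ)), ∃ s : Finset (ConjClasses (cmDatum L N H).arithmeticSubgroup),
        (∀ c ∉ s, descConj ((Quotient.out c : (cmDatum L N H).arithmeticSubgroup) :
            (cmDatum L N H).Adelic)
          (Subgroup.centralizer ({((Quotient.out c : (cmDatum L N H).arithmeticSubgroup) :
            (cmDatum L N H).Adelic)} : Set (cmDatum L N H).Adelic))
          (fun _ hg => Subgroup.mem_centralizer_singleton_iff.1 hg)
          (mulConv ν (⇑f) (mulStar (⇑f))) = 0) ∧
        ∀ {ι : Type*} [Countable ι] (b : HilbertBasis ι ℂ ((cmDatum L N H).L2 μ)),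
          HasSum (fun i => ((‖((cmDatum L N H).rightRegular μ).integratedOperator
              ((cmDatum L N H).isUnitary_rightRegular μ)
              ((cmDatum L N H).isStronglyContinuous_rightRegular_holds μ) ν f (b i)‖ ^ 2 : ℝ) : ℂ))
            (((C : ℝ) : ℂ) * ∑ c ∈ s, ((dc c).toReal : ℂ) * ∫ y, descConj
                ((Quotient.out c : (cmDatum L N H).arithmeticSubgroup) : (cmDatum L N H).Adelic)
                (Subgroup.centralizer ({((Quotient.out c : (cmDatum L N H).arithmeticSubgroup) :
                  (cmDatum L N H).Adelic)} : Set (cmDatum L N H).Adelic))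
                (fun _ hg => Subgroup.mem_centralizer_singleton_iff.1 hg)
                (mulConv ν (⇑f) (mulStar (⇑f))) y ∂(μC c)) := by
  obtain ⟨C, dc, μC, hC, hdc, hμC, hf⟩ :=
    hasSum_norm_sq_integratedOperator_eq_const_mul_tsum_orbital_cmDatum L N H hanis μ ν
  refine ⟨C, dc, μC, hC, hdc, hμC, fun f => ?_⟩
  -- `f ⋆ f^* ∈ C_c`
  obtain ⟨F, hF⟩ : ∃ F : C_c((cmDatum L N H).Adelic, ℂ),
      (⇑F : (cmDatum L N H).Adelic → ℂ) = mulConv ν (⇑f) (mulStar (⇑f)) := by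
    haveI : ν.IsMulRightInvariant := isMulRightInvariant_cmDatum L N H hanis ν
    exact ⟨⟨⟨mulConv ν (⇑f) (mulStar (⇑f)), continuous_mulConv ν f.continuous f.hasCompactSupport
      (continuous_mulStar f.continuous)⟩,
      hasCompactSupport_mulConv ν f.hasCompactSupport (hasCompactSupport_mulStar f.hasCompactSupport)⟩,
      rfl⟩
  obtain ⟨s, hs⟩ := exists_finset_descConj_eq_zero_cmDatum L N H hanis F
    (fun c => Subgroup.centralizer ({((Quotient.out c : (cmDatum L N H).arithmeticSubgroup) :
      (cmDatum L N H).Adelic)} : Set (cmDatum L N H).Adelic))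
    (fun c => fun _ hg => Subgroup.mem_centralizer_singleton_iff.1 hg)
  rw [hF] at hs
  refine ⟨s, hs, fun {ι} _ b => ?_⟩
  obtain ⟨-, -, hHS⟩ := hf f b
  rw [tsum_eq_sum (s := s) fun c hc => by rw [hs c hc, Pi.zero_def, integral_zero, mul_zero]]
    at hHS
  exact hHS

end UnitaryGroup

end Literature.NumberTheory.Automorphic
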